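import Summits.BirchSwinnertonDyer.BirchSwinnertonDyer.Theorems.EisensteinPrimesX1AnalyticLambdaCalculus
import Summits.BirchSwinnertonDyer.BirchSwinnertonDyer.Theorems.EisensteinPrimesAlgebraicLambdaGEIsogeny
import Summits.BirchSwinnertonDyer.Rank1Residual.X2.IsogenyClassStability
import HarnessLib

/-!
# Route `EisensteinPrimes`, line `mudescent`: the conclusion of `stub_lambdaCount_offLocus` is a
# ℚ-ISOGENY-CLASS statement in both currencies — at the located member `W₀` it is the same
# statement as at the displayed member `W` (helper file; closes nothing)

Seat `bsd-eis-lam-a` (PROGRAMME PART 1b, ACCEL-LIST (4)); items stmt-BirchSwinnertonDyer-19033 (crux 3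
`MazurMCOnCellB`, X2) and -19035 (crux 5 `MazurMCOnX1RankZero`, X1); skeleton owner bsd-eis-ky.

HONEST FRAMING. Theorems only; nothing here proves a main conjecture. This file COMBINES the two
class-invariance results now in the tree — the analytic conjunct (this seat:
`EisensteinPrimesAnalyticLambdaCalculus.analyticLambdaEq_iff_of_isIsogenous`,
`EisensteinPrimesX1AnalyticLambdaCalculus.analyticLambdaEq_of_isIsogenous`) and the algebraic conjunct
(seat lam-b: `EisensteinPrimesAlgebraicLambdaGEIsogeny.algebraicLambdaGE_at_located`, p459740) — with
the invariance of the split/non-split type (`X2.IsogenyQuotientLine.…_iff_of_isIsogenous`) and of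
reducibility (`not_hasIrreducibleModPGaloisRep_of_isIsogenous`), into the shape the skeletons consume
after `stub_locate W p … = ⟨W₀, _, _, hiso, hoff⟩`:

* `lambdaCount_of_isIsogenous` (X2): the registered conclusion
  `∃ n k, X2.AnalyticLambdaEq · p n ∧ AlgebraicLambdaGE · p k ∧ (¬split → n ≤ k) ∧ (split → n ≤ k+1)`
  passes from ANY member `W` to any ℚ-isogenous `W₀` (granted Wuthrich 2014 Thm. 16 `hWu` and
  modularity `hpar`, at an odd reducible multiplicative `p`) — and back (`lambdaCount_iff_of_isIsogenous`).
* `lambdaCount_of_isIsogenous_goodOrd` (X1): the same for `∃ n k, X1.AnalyticLambdaEq · p n ∧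
  AlgebraicLambdaGE · p k ∧ n ≤ k` at an odd reducible good ordinary `p` (granted
  `Wuthrich2014.charIdeal_dvd_padicLFunction` for the integral datum at the source).

CONSEQUENCE FOR THE LINE (numbers, not adjectives): stub 4 of `mudescent` at the étale end `W₀` is
EXACTLY stub 4 at the displayed pair `(W, p)` — per pair it is the census certificate
(`AnalyticLambdaEq W p n` binder of the route-G/route-T displays) plus an `AlgebraicLambdaGE W p k`
witness; class-wide it is the `λ`-half of Mazur's main conjecture (files `…AnalyticLambdaCruxSized`,
`…X1AnalyticLambdaCalculus`). The descent `stub_locate` is needed for the μ-stub only.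

References: [GreenbergVatsal2000] p. 28 ("The λ-invariant is always unchanged by an isogeny");
[Wuthrich2014] Thm. 16; HOME/lam-b-MEMO-1.md §5 (H1).
-/

set_option linter.dupNamespace false
set_option autoImplicit false

noncomputable section

open scoped Classical MatrixGroups ModularForm

open PowerSeries CongruenceSubgroup WeierstrassCurve Literature.NumberTheory.EllipticCurves
  Literature.NumberTheory.EllipticCurves.ModularForms
  Literature.NumberTheory.EllipticCurves.Rank1Residual
  Literature.NumberTheory.EllipticCurves.Wuthrich2014
  Summit.BirchSwinnertonDyer.Rank1Residual
  Summit.BirchSwinnertonDyer.Rank1Residual.X1.MuLambda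
  Summit.BirchSwinnertonDyer.Rank1Residual.X1.ParitySqueeze
  Summit.BirchSwinnertonDyer.Rank1Residual.X1.TamagawaSqueeze
  Summit.BirchSwinnertonDyer.BirchSwinnertonDyer.Theorems

namespace Summit.BirchSwinnertonDyer.BirchSwinnertonDyer.Theorems.EisensteinPrimesLambdaCountIsogeny

variable {W W₀ : WeierstrassCurve ℚ} [W.IsElliptic] [W.IsGloballyMinimal] [W₀.IsElliptic]
  [W₀.IsGloballyMinimal] {p : ℕ} [Fact p.Prime]

/-! ## X2 currency (crux 3, `p ‖ N`) -/

/-- **The X2 conclusion of `stub_lambdaCount_offLocus` transports along a ℚ-isogeny.** `W ∼ W₀`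
globally minimal, `p ≠ 2` reducible multiplicative for `W`; granted Wuthrich 2014 Thm. 16 (`hWu`)
and modularity (`hpar`). The analytic conjunct moves by
`analyticLambdaEq_iff_of_isIsogenous`, the algebraic one by lam-b's `algebraicLambdaGE_at_located`,
the split/non-split clause by `hasSplitMultiplicativeReductionAtPrime_iff_of_isIsogenous`.
[cite: GreenbergVatsal2000, p. 28] [cite: Wuthrich2014, Thm. 16 (p. 397)] -/
theorem lambdaCount_of_isIsogenous (hWu : thm16_charIdeal_dvd_multiplicative_of_reducible)
    (hpar : nonempty_modularParametrizationData) (hiso : IsIsogenous W W₀) (hp2 : p ≠ 2)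
    (hmult : W.HasMultiplicativeReductionAtPrime p) (hred : ¬ W.HasIrreducibleModPGaloisRep p)
    (h : ∃ n k : ℕ, X2.AnalyticLambdaEq W p n ∧ AlgebraicLambdaGE W p k ∧
      (¬ W.HasSplitMultiplicativeReductionAtPrime p → n ≤ k) ∧
      (W.HasSplitMultiplicativeReductionAtPrime p → n ≤ k + 1)) :
    ∃ n k : ℕ, X2.AnalyticLambdaEq W₀ p n ∧ AlgebraicLambdaGE W₀ p k ∧
      (¬ W₀.HasSplitMultiplicativeReductionAtPrime p → n ≤ k) ∧
      (W₀.HasSplitMultiplicativeReductionAtPrime p → n ≤ k + 1) := by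
  obtain ⟨n, k, hlam, halg, hkN, hkS⟩ := h
  have hred₀ : ¬ W₀.HasIrreducibleModPGaloisRep p :=
    not_hasIrreducibleModPGaloisRep_of_isIsogenous (p := p) hiso hred
  have hsplit : W.HasSplitMultiplicativeReductionAtPrime p ↔
      W₀.HasSplitMultiplicativeReductionAtPrime p :=
    X2.IsogenyQuotientLine.hasSplitMultiplicativeReductionAtPrime_iff_of_isIsogenous hiso
  exact ⟨n, k, (EisensteinPrimesAnalyticLambdaCalculus.analyticLambdaEq_iff_of_isIsogenous hWu hpar
      hiso hp2 hmult hred hred₀ n).mp hlam,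
    EisensteinPrimesAlgebraicLambdaGEIsogeny.algebraicLambdaGE_at_located hiso halg,
    fun hns ↦ hkN (fun hs ↦ hns (hsplit.mp hs)), fun hs ↦ hkS (hsplit.mpr hs)⟩

/-- **`iff` form**: the X2 conclusion of the stub is CONSTANT on the ℚ-isogeny class (at an odd
reducible multiplicative `p`; `hWu`, `hpar` as above). In the skeleton `MazurMCOnCellB_of`, the stub
at the located `W₀` is the stub at the displayed `W`. [cite: GreenbergVatsal2000, p. 28] -/
theorem lambdaCount_iff_of_isIsogenous (hWu : thm16_charIdeal_dvd_multiplicative_of_reducible)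
    (hpar : nonempty_modularParametrizationData) (hiso : IsIsogenous W W₀) (hp2 : p ≠ 2)
    (hmult : W.HasMultiplicativeReductionAtPrime p) (hred : ¬ W.HasIrreducibleModPGaloisRep p) :
    (∃ n k : ℕ, X2.AnalyticLambdaEq W p n ∧ AlgebraicLambdaGE W p k ∧
      (¬ W.HasSplitMultiplicativeReductionAtPrime p → n ≤ k) ∧
      (W.HasSplitMultiplicativeReductionAtPrime p → n ≤ k + 1)) ↔
    (∃ n k : ℕ, X2.AnalyticLambdaEq W₀ p n ∧ AlgebraicLambdaGE W₀ p k ∧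
      (¬ W₀.HasSplitMultiplicativeReductionAtPrime p → n ≤ k) ∧
      (W₀.HasSplitMultiplicativeReductionAtPrime p → n ≤ k + 1)) := by
  refine ⟨lambdaCount_of_isIsogenous hWu hpar hiso hp2 hmult hred, fun h ↦ ?_⟩
  have hred₀ : ¬ W₀.HasIrreducibleModPGaloisRep p :=
    not_hasIrreducibleModPGaloisRep_of_isIsogenous (p := p) hiso hred
  have hmult₀ : W₀.HasMultiplicativeReductionAtPrime p :=
    X2.IsogenyQuotientLine.hasMultiplicativeReductionAtPrime_of_isIsogenous hiso hmult
  exact lambdaCount_of_isIsogenous hWu hpar hiso.symm_of_charZero hp2 hmult₀ hred₀ h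

/-! ## X1 currency (crux 5, good ordinary anomalous `p`) -/

/-- **The X1 conclusion of `stub_lambdaCount_offLocus` transports along a ℚ-isogeny.** `W ∼ W₀`
globally minimal, `p ≠ 2` good ordinary for `W` with `E[p]` reducible; granted
`Wuthrich2014.charIdeal_dvd_padicLFunction` (`hW16`, the integral datum at `W`) and modularity
(`hpar`): `∃ n k, X1.AnalyticLambdaEq W p n ∧ AlgebraicLambdaGE W p k ∧ n ≤ k` at `W` gives the same at
`W₀` (analytic conjunct: `EisensteinPrimesX1AnalyticLambdaCalculus.analyticLambdaEq_of_isIsogenous`;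
algebraic: lam-b's `algebraicLambdaGE_at_located`). [cite: GreenbergVatsal2000, p. 28]
[cite: Wuthrich2014, Thm. 16 (p. 397)] -/
theorem lambdaCount_of_isIsogenous_goodOrd (hW16 : Wuthrich2014.charIdeal_dvd_padicLFunction)
    (hpar : nonempty_modularParametrizationData) (hiso : IsIsogenous W W₀) (hp2 : p ≠ 2)
    (hgood : W.HasGoodReductionAtPrime p) (hord : ¬ (p : ℤ) ∣ W.frobeniusTrace p)
    (hred : ¬ W.HasIrreducibleModPGaloisRep p) (hgood₀ : W₀.HasGoodReductionAtPrime p)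
    (h : ∃ n k : ℕ, X1.ParitySqueeze.AnalyticLambdaEq W p n ∧ AlgebraicLambdaGE W p k ∧ n ≤ k) :
    ∃ n k : ℕ, X1.ParitySqueeze.AnalyticLambdaEq W₀ p n ∧ AlgebraicLambdaGE W₀ p k ∧ n ≤ k := by
  obtain ⟨n, k, hlam, halg, hnk⟩ := h
  -- the integral datum at `W` from Wuthrich Thm. 16 at the cyclotomic datum
  have hint : ∀ [NeZero (W.conductorNorm ℤ)] (f : CuspForm (Gamma0 (W.conductorNorm ℤ)) 2),
      IsNewformOf W f → ∀ ϖ : ℚ, (ϖ : ℝ) * W.realPeriodRat = plusPeriod f →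
      ∃ g : IwasawaAlgebra p,
        iwasawaToPowerSeries p g = C (ϖ : ℚ_[p]) * padicLFunction f (unitRoot W p : ℚ_[p]) := by
    intro _ f hf ϖ hϖ
    obtain ⟨κ, hκ, γ, hγ, hγ'⟩ := exists_isCyclotomic_isTopGenerator_isCyclotomicVariable_holds p
    obtain ⟨D⟩ := W.nonempty_selmerDualData_holds κ γ hγ
    obtain ⟨-, g, -, hg⟩ := hW16 W p hp2 ⟨hgood, hord⟩ hred hκ hγ hγ' hf D ϖ hϖ
    exact ⟨g, hg⟩
  exact ⟨n, k, EisensteinPrimesX1AnalyticLambdaCalculus.analyticLambdaEq_of_isIsogenous hpar hiso hgood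
      hgood₀ hint hlam,
    EisensteinPrimesAlgebraicLambdaGEIsogeny.algebraicLambdaGE_at_located hiso halg, hnk⟩

end Summit.BirchSwinnertonDyer.BirchSwinnertonDyer.Theorems.EisensteinPrimesLambdaCountIsogeny

end
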